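import Literature.MathematicalPhysics.QuantumLattice.LTQOProofs
import Literature.MathematicalPhysics.QuantumLattice.FinDimSpectrumSectorGibbsLimit
import Mathlib.Data.Rat.Denumerable
import Mathlib.Data.Nat.Pairing
import Mathlib.Data.Nat.Prime.Infinite
import HarnessLib

/-!
# Crux `BirGroundStateAverageLRO` (item `stmt-HubbardSuperconductivity-2079`): the window-uniformisation bridge is tight — per-coupling every-ground-state floors do NOT give one constant at every coupling

Helper file `--supports stmt-HubbardSuperconductivity-2079` (THESES-FREE, abstract linear algebra;
nothing here mentions a Theses declaration). The target
`Theses.BalabanIR.BirGroundStateAverageLRO` asks `∃ c > 0` BEFORE `∀ U ∈ (U₁, U₂)`: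
ONE constant for the ground-state-AVERAGE pair intensity at EVERY coupling of a window. The
uniformisation bridge `Theorems/BalabanIRBirGroundStateAverageLROWindowUniformisationCountable.lean`
/ `…OfEveryCouplingLRO.lean` (prover seat 2, 2026-08-17) shows that a POINTWISE floor (each
coupling with its own constant) — in particular per-coupling every-ground-state pair order, the
output of any `HasDWavePairFieldLROAt`-type engine — already yields one constant on a sub-window
at every coupling OUTSIDE a countable union of level-crossing sets, using only that
`U ↦ hubbardTorus 2 L 1 U` is an affine Hermitian pencil preserving the sector.

This file certifies that the countable exceptional set cannot be removed by such abstract means: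
`exists_affinePencil_pointwiseFloor_not_uniformAverage` exhibits a family of affine Hermitian
pencils `H_L(U) = T_L + U • D_L` (diagonal, size `L + 3`) with observables `0 ≤ A_L ≤ 1` such
that

* at EVERY coupling `U ∈ (0,1)` and for EVERY size `L`, every ground state `ψ` of `H_L(U)` has
  `c_U ‖ψ‖² ≤ Re ⟨ψ, A_L ψ⟩` with a constant `c_U > 0` depending on `U` only (the strongest
  per-coupling hypothesis: every-ground-state order with `L₀ = 1`), yet
* on EVERY sub-window `(a,b) ⊆ [0,1]` and for EVERY `c > 0` some coupling `U ∈ (a,b)` has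
  `Re tr (P A_L) < c · Re tr P` for infinitely many (even) `L`, `P` the projection onto the
  ground eigenspace — the target's quantifier shape fails.

Mechanism ("a high-multiplicity affine branch tangent to the ground energy at a rational
coupling"): size `L` carries a *touching coupling* `x_L ∈ ℚ` (an enumeration of `ℚ` in which
every rational recurs at infinitely many even `L`), two base states with energies `0` and
`x_L - U` and `A`-weight `1`, and `L + 1` degenerate states with energy `(x_L - U)/2` and
`A`-weight `1/den(x_L)`. For `U ≠ x_L` the degenerate branch lies strictly above the ground
energy `min(0, x_L - U)`, so ground states live on the base (`⟨A⟩ = ‖ψ‖²`); at `U = x_L` the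
whole space is the ground space and the average of `A` is `(2 + (L+1)/den x_L)/(L+3) → 1/den x_L`,
which is arbitrarily small on every sub-window (rationals of large denominator are dense), while
the every-ground-state floor at a rational coupling `q` is `1/den q > 0` uniformly in `L`.

Consequences recorded in `Cruxes/BirGroundStateAverageLRO/Lines/BridgeTightness-c21.md`: a route
that outputs per-coupling order reaches the CO-COUNTABLE form of the target
(`birGroundStateAverageLRO_coCountable_of_forall_hasDWavePairFieldLROAt`) and not the target as
typed; the as-typed target is fed only by an engine whose constants are uniform in `U` by
construction (the route's chain `BirComplexStableXYR → BirGappedPhaseReductionR`) or by the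
summit-strength every-ground-state WINDOW form. Folklore finite-dimensional linear algebra; no
named facts, no definitions.
-/

noncomputable section

namespace Summit.HubbardSuperconductivity.HubbardSuperconductivity.Theorems.BirGroundStateAverageLRO.Negative

open Matrix Finset
open Literature.MathematicalPhysics.QuantumLattice
open scoped ComplexOrder

variable {ι : Type*} [Fintype ι] [DecidableEq ι]

/-- `Re ⟨ψ, diag(w) ψ⟩ = Σᵢ wᵢ ‖ψᵢ‖²` for a real diagonal matrix. [folklore] -/
theorem re_star_dotProduct_diagonal_mulVec (w : ι → ℝ) (ψ : ι → ℂ) :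
    (star ψ ⬝ᵥ (diagonal fun i => (w i : ℂ)) *ᵥ ψ).re = ∑ i, w i * ‖ψ i‖ ^ 2 := by
  simp only [dotProduct, mulVec_diagonal, Pi.star_apply, Complex.re_sum]
  refine Finset.sum_congr rfl fun i _ => ?_
  have h : star (ψ i) * ((w i : ℂ) * ψ i) = ((w i * ‖ψ i‖ ^ 2 : ℝ) : ℂ) := by
    rw [mul_left_comm, Complex.star_def, Complex.conj_mul', Complex.ofReal_mul, Complex.ofReal_pow]
  rw [h, Complex.ofReal_re]

omit [DecidableEq ι] in
/-- `Re ⟨ψ, ψ⟩ = Σᵢ ‖ψᵢ‖²`. [folklore] -/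
theorem re_star_dotProduct_self (ψ : ι → ℂ) : (star ψ ⬝ᵥ ψ).re = ∑ i, ‖ψ i‖ ^ 2 := by
  simp only [dotProduct, Pi.star_apply, Complex.re_sum]
  refine Finset.sum_congr rfl fun i _ => ?_
  rw [Complex.star_def, Complex.conj_mul', ← Complex.ofReal_pow, Complex.ofReal_re]

/-- Rationals of arbitrarily large denominator are dense: every real interval contains a rational
`q` with `den q > M` (take `q = k/p` for a prime `p > max (M, 2/(b-a))` and `k` or `k+1` prime
to `p`, `k = ⌊a p⌋ + 1`). [folklore] -/
theorem exists_rat_mem_Ioo_lt_den {a b : ℝ} (ha : 0 ≤ a) (hab : a < b) (M : ℝ) :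
    ∃ q : ℚ, a < q ∧ (q : ℝ) < b ∧ M < q.den := by
  obtain ⟨p, hpN, hp⟩ := Nat.exists_infinite_primes (⌈max M (2 / (b - a))⌉₊ + 1)
  have hpM : M < p := by
    have h1 : max M (2 / (b - a)) ≤ ⌈max M (2 / (b - a))⌉₊ := Nat.le_ceil _
    have h2 : (⌈max M (2 / (b - a))⌉₊ : ℝ) + 1 ≤ p := by exact_mod_cast hpN
    linarith [le_max_left M (2 / (b - a))]
  have hpgap : 2 / (b - a) < p := by
    have h1 : max M (2 / (b - a)) ≤ ⌈max M (2 / (b - a))⌉₊ := Nat.le_ceil _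
    have h2 : (⌈max M (2 / (b - a))⌉₊ : ℝ) + 1 ≤ p := by exact_mod_cast hpN
    linarith [le_max_right M (2 / (b - a))]
  have hp0 : (0 : ℝ) < p := by exact_mod_cast hp.pos
  have hba : 0 < b - a := sub_pos.2 hab
  have h2p : 2 / (p : ℝ) < b - a := by
    rw [div_lt_iff₀ hp0]
    have := (div_lt_iff₀ hba).1 hpgap
    linarith
  -- the numerator: `k = ⌊a p⌋ + 1` or `k + 1`, whichever is prime to `p`
  set k : ℕ := ⌊a * p⌋₊ + 1 with hk
  have hak : a * p < k := by
    rw [hk]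
    push_cast
    exact Nat.lt_floor_add_one _
  have hka : (k : ℝ) ≤ a * p + 1 := by
    rw [hk]
    push_cast
    linarith [Nat.floor_le (mul_nonneg ha hp0.le)]
  have hcop : ∃ k' : ℕ, k ≤ k' ∧ k' ≤ k + 1 ∧ Nat.Coprime k' p := by
    by_cases hdvd : p ∣ k
    · refine ⟨k + 1, Nat.le_succ k, le_rfl, ?_⟩
      refine (Nat.Coprime.symm ((Nat.Prime.coprime_iff_not_dvd hp).2 fun h => ?_))
      have h1 : p ∣ 1 := by
        have := Nat.dvd_sub h hdvd
        simpa using this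
      exact hp.one_lt.ne' (Nat.dvd_one.1 h1)
    · exact ⟨k, le_rfl, Nat.le_succ k, ((Nat.Prime.coprime_iff_not_dvd hp).2 hdvd).symm⟩
  obtain ⟨k', hkk', hk'k, hcop'⟩ := hcop
  refine ⟨(k' : ℚ) / p, ?_, ?_, ?_⟩
  · have h1 : a < (k : ℝ) / p := by rw [lt_div_iff₀ hp0]; exact hak
    have h2 : (k : ℝ) / p ≤ (k' : ℝ) / p :=
      div_le_div_of_nonneg_right (by exact_mod_cast hkk') hp0.le
    have h3 : (((k' : ℚ) / p : ℚ) : ℝ) = (k' : ℝ) / p := by push_cast; ring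
    rw [h3]
    exact lt_of_lt_of_le h1 h2
  · have h3 : (((k' : ℚ) / p : ℚ) : ℝ) = (k' : ℝ) / p := by push_cast; ring
    rw [h3, div_lt_iff₀ hp0]
    have h4 : (k' : ℝ) ≤ k + 1 := by exact_mod_cast hk'k
    have h5 : a * p + 2 < b * p := by
      have := (div_lt_iff₀ hp0).1 h2p
      nlinarith
    linarith
  · have hden : ((((k' : ℤ) : ℚ) / ((p : ℤ) : ℚ)).den : ℤ) = p :=
      Rat.den_div_eq_of_coprime (by exact_mod_cast hp.pos) (by simpa using hcop')
    have hden' : (((k' : ℚ) / p).den : ℤ) = p := by simpa using hden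
    have hden'' : ((k' : ℚ) / p).den = p := by exact_mod_cast hden'
    rw [hden'']
    exact hpM

/-- **Tightness of the window-uniformisation bridge.** There is a family of affine Hermitian
pencils `H_L(U) = T_L + U • D_L` on `ℂ^{Fin 2 ⊕ Fin (L+1)}` with observables `A_L`,
`0 ≤ A_L ≤ 1`, such that (i) at every coupling `U ∈ (0,1)`, for every size `L`, every ground
state `ψ` of `H_L(U)` (sector `⊤`) satisfies `c_U · ‖ψ‖² ≤ Re ⟨ψ, A_L ψ⟩` with `c_U > 0`
depending on `U` only, and yet (ii) for every sub-window `(a,b) ⊆ [0,1]` and every `c > 0`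
there is a coupling `U ∈ (a,b)` at which `Re tr (P A_L) < c · Re tr P` for infinitely many even
`L` (`P` the orthogonal projection onto the ground eigenspace
`⊤ ⊓ eigenspace (H_L(U)) (minEnergyOn (H_L(U)) ⊤)`, the shape of the target's `E₀`, `P`).
So "pointwise (even every-ground-state) floor ⇒ one constant at EVERY coupling of a sub-window"
is false for affine pencils: the countable exceptional set of
`dWaveAvg_uniform_offCountable_of_pointwise` is unavoidable abstractly. [folklore] -/
theorem exists_affinePencil_pointwiseFloor_not_uniformAverage :
    ∃ T D A : (L : ℕ) → Matrix (Fin 2 ⊕ Fin (L + 1)) (Fin 2 ⊕ Fin (L + 1)) ℂ,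
      (∀ L, (T L).IsHermitian) ∧ (∀ L, (D L).IsHermitian) ∧ (∀ L, (A L).PosSemidef) ∧
      (∀ (L : ℕ) (ψ : Fin 2 ⊕ Fin (L + 1) → ℂ),
        (star ψ ⬝ᵥ A L *ᵥ ψ).re ≤ (star ψ ⬝ᵥ ψ).re) ∧
      (∀ U ∈ Set.Ioo (0 : ℝ) 1, ∃ c : ℝ, 0 < c ∧ ∀ (L : ℕ) (ψ : Fin 2 ⊕ Fin (L + 1) → ℂ),
        let H := T L + (U : ℂ) • D L
        let E₀ := (⊤ : Submodule ℂ (Fin 2 ⊕ Fin (L + 1) → ℂ)) ⊓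
          Module.End.eigenspace (Matrix.toLin' H) ((H.minEnergyOn ⊤ : ℝ) : ℂ)
        ψ ∈ E₀ → c * (star ψ ⬝ᵥ ψ).re ≤ (star ψ ⬝ᵥ A L *ᵥ ψ).re) ∧
      (∀ a b c : ℝ, 0 ≤ a → a < b → b ≤ 1 → 0 < c → ∃ U ∈ Set.Ioo a b, ∀ L₀ : ℕ, ∃ L : ℕ,
        L₀ ≤ L ∧ Even L ∧
        let H := T L + (U : ℂ) • D L
        let E₀ := (⊤ : Submodule ℂ (Fin 2 ⊕ Fin (L + 1) → ℂ)) ⊓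
          Module.End.eigenspace (Matrix.toLin' H) ((H.minEnergyOn ⊤ : ℝ) : ℂ)
        let P := projMatrix (E₀.map ((WithLp.linearEquiv 2 ℂ (Fin 2 ⊕ Fin (L + 1) → ℂ)).symm :
          (Fin 2 ⊕ Fin (L + 1) → ℂ) →ₗ[ℂ] EuclideanSpace ℂ (Fin 2 ⊕ Fin (L + 1))))
        (P * A L).trace.re < c * P.trace.re) := by
  classical
  -- touching coupling of size `L` (every rational recurs at infinitely many even `L`)
  let x : ℕ → ℚ := fun L => (Denumerable.eqv ℚ).symm (L / 2).unpair.1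
  -- real diagonal data
  let tR : (L : ℕ) → (Fin 2 ⊕ Fin (L + 1)) → ℝ :=
    fun L => Sum.elim ![0, (x L : ℝ)] (fun _ => (x L : ℝ) / 2)
  let dR : (L : ℕ) → (Fin 2 ⊕ Fin (L + 1)) → ℝ :=
    fun L => Sum.elim ![0, -1] (fun _ => -(1 / 2))
  let wR : (L : ℕ) → (Fin 2 ⊕ Fin (L + 1)) → ℝ :=
    fun L => Sum.elim ![1, 1] (fun _ => ((x L).den : ℝ)⁻¹)
  have hw_nonneg : ∀ L i, 0 ≤ wR L i := by
    intro L i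
    rcases i with i | j
    · fin_cases i <;> simp [wR]
    · simp only [wR, Sum.elim_inr]; positivity
  have hw_le_one : ∀ L i, wR L i ≤ 1 := by
    intro L i
    rcases i with i | j
    · fin_cases i <;> simp [wR]
    · simp only [wR, Sum.elim_inr]
      exact inv_le_one_of_one_le₀ (by exact_mod_cast (x L).den_pos)
  have hw_den : ∀ L i, ((x L).den : ℝ)⁻¹ ≤ wR L i := by
    intro L i
    have hle : ((x L).den : ℝ)⁻¹ ≤ 1 :=
      inv_le_one_of_one_le₀ (by exact_mod_cast (x L).den_pos)
    rcases i with i | j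
    · fin_cases i <;> simpa [wR] using hle
    · simp [wR]
  -- the pencil is the real diagonal matrix `diag (tR + U dR)`
  have hpencil : ∀ (L : ℕ) (U : ℝ),
      (diagonal fun i => (tR L i : ℂ)) + (U : ℂ) • (diagonal fun i => (dR L i : ℂ)) =
        diagonal fun i => ((tR L i + U * dR L i : ℝ) : ℂ) := by
    intro L U
    rw [← diagonal_smul, diagonal_add]
    congr 1
    ext i
    simp only [Pi.smul_apply, smul_eq_mul]
    push_cast
    ring
  have hherm : ∀ (L : ℕ) (v : Fin 2 ⊕ Fin (L + 1) → ℝ),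
      (diagonal fun i => (v i : ℂ)).IsHermitian := by
    intro L v
    exact isHermitian_diagonal_iff.2 fun i => by
      rw [isSelfAdjoint_iff, Complex.star_def, Complex.conj_ofReal]
  -- Rayleigh quotient and norm of a coordinate vector against a real diagonal matrix
  have hray : ∀ (L : ℕ) (v : Fin 2 ⊕ Fin (L + 1) → ℝ) (i : Fin 2 ⊕ Fin (L + 1)),
      (star (Pi.single i (1 : ℂ) : Fin 2 ⊕ Fin (L + 1) → ℂ) ⬝ᵥ
        (diagonal fun i => (v i : ℂ)) *ᵥ Pi.single i 1).re = v i := by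
    intro L v i
    rw [Pi.star_single, star_one, diagonal_mulVec_single, single_one_dotProduct]
    simp
  have hunit : ∀ (L : ℕ) (i : Fin 2 ⊕ Fin (L + 1)),
      star (Pi.single i (1 : ℂ) : Fin 2 ⊕ Fin (L + 1) → ℂ) ⬝ᵥ Pi.single i 1 = 1 := by
    intro L i
    rw [Pi.star_single, star_one, single_one_dotProduct]
    simp
  -- off the touching coupling, ground states live on the two base coordinates
  have hvanish : ∀ (L : ℕ) (U : ℝ), (x L : ℝ) ≠ U →
      ∀ ψ : Fin 2 ⊕ Fin (L + 1) → ℂ,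
        ψ ∈ Module.End.eigenspace (Matrix.toLin' (diagonal fun i => ((tR L i + U * dR L i : ℝ) : ℂ)))
          ((((diagonal fun i => ((tR L i + U * dR L i : ℝ) : ℂ)).minEnergyOn ⊤ : ℝ)) : ℂ) →
        ∀ j : Fin (L + 1), ψ (Sum.inr j) = 0 := by
    intro L U hxU ψ hψ j
    set v : Fin 2 ⊕ Fin (L + 1) → ℝ := fun i => tR L i + U * dR L i with hv
    set e : ℝ := (diagonal fun i => (v i : ℂ)).minEnergyOn ⊤ with he
    -- `e ≤ 0` and `e ≤ x_L - U` (Rayleigh quotients of the base coordinates)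
    have hv0 : v (Sum.inl 0) = 0 := by simp [hv, tR, dR]
    have hv1 : v (Sum.inl 1) = (x L : ℝ) - U := by simp [hv, tR, dR]; ring
    have hvj : v (Sum.inr j) = ((x L : ℝ) - U) / 2 := by simp [hv, tR, dR]; ring
    have he0 : e ≤ 0 := by
      have h := minEnergyOn_le_rayleigh_of_mem (hherm L v) ⊤ (Submodule.mem_top
        (x := (Pi.single (Sum.inl 0) (1 : ℂ) : Fin 2 ⊕ Fin (L + 1) → ℂ))) (hunit L _)
      rw [hray, hv0] at h
      exact h
    have he1 : e ≤ (x L : ℝ) - U := by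
      have h := minEnergyOn_le_rayleigh_of_mem (hherm L v) ⊤ (Submodule.mem_top
        (x := (Pi.single (Sum.inl 1) (1 : ℂ) : Fin 2 ⊕ Fin (L + 1) → ℂ))) (hunit L _)
      rw [hray, hv1] at h
      exact h
    have hlt : e < ((x L : ℝ) - U) / 2 := by
      rcases lt_or_gt_of_ne (sub_ne_zero.2 hxU) with h | h
      · linarith
      · linarith
    -- the eigenvalue equation on the coordinate `inr j`
    have hψv : ψ ∈ Module.End.eigenspace (Matrix.toLin' (diagonal fun i => (v i : ℂ))) (e : ℂ) :=
      hψ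
    have heq : (diagonal fun i => (v i : ℂ)) *ᵥ ψ = (e : ℂ) • ψ := by
      simpa only [Module.End.mem_eigenspace_iff, Matrix.toLin'_apply] using hψv
    have hcomp := congrFun heq (Sum.inr j)
    simp only [mulVec_diagonal, Pi.smul_apply, smul_eq_mul] at hcomp
    rw [hvj] at hcomp
    have hne : ((((x L : ℝ) - U) / 2 : ℝ) : ℂ) - (e : ℂ) ≠ 0 := by
      rw [← Complex.ofReal_sub, Ne, Complex.ofReal_eq_zero]
      exact (sub_pos.2 hlt).ne'
    have : (((((x L : ℝ) - U) / 2 : ℝ) : ℂ) - (e : ℂ)) * ψ (Sum.inr j) = 0 := by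
      rw [sub_mul, hcomp, sub_self]
    exact (mul_eq_zero.1 this).resolve_left hne
  refine ⟨fun L => diagonal fun i => (tR L i : ℂ), fun L => diagonal fun i => (dR L i : ℂ),
    fun L => diagonal fun i => (wR L i : ℂ), fun L => hherm L _, fun L => hherm L _,
    fun L => posSemidef_diagonal_iff.2 fun i => Complex.zero_le_real.2 (hw_nonneg L i),
    ?_, ?_, ?_⟩
  · -- `A ≤ 1`
    intro L ψ
    rw [re_star_dotProduct_diagonal_mulVec, re_star_dotProduct_self]
    exact Finset.sum_le_sum fun i _ => mul_le_of_le_one_left (sq_nonneg _) (hw_le_one L i)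
  · -- (i) the per-coupling every-ground-state floor
    intro U _hU
    by_cases hrat : ∃ q : ℚ, (q : ℝ) = U
    · obtain ⟨q, rfl⟩ := hrat
      refine ⟨((q.den : ℝ))⁻¹, by positivity, fun L ψ => ?_⟩
      intro H E₀ hψ
      rw [re_star_dotProduct_diagonal_mulVec, re_star_dotProduct_self, Finset.mul_sum]
      by_cases hx : x L = q
      · -- at the touching coupling: `A ≥ (1/den q) · 1`
        refine Finset.sum_le_sum fun i _ => mul_le_mul_of_nonneg_right ?_ (sq_nonneg _)
        have := hw_den L i
        rwa [hx] at this
      · have hxU : (x L : ℝ) ≠ (q : ℝ) := fun h => hx (by exact_mod_cast h)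
        have hH : H = diagonal fun i => ((tR L i + (q : ℝ) * dR L i : ℝ) : ℂ) := hpencil L q
        have hψ' := (Submodule.mem_inf.1 hψ).2
        rw [hH] at hψ'
        have hz := hvanish L q hxU ψ hψ'
        refine Finset.sum_le_sum fun i _ => ?_
        rcases i with i | j
        · refine mul_le_mul_of_nonneg_right ?_ (sq_nonneg _)
          have h1 : ((q.den : ℝ))⁻¹ ≤ 1 := inv_le_one_of_one_le₀ (by exact_mod_cast q.den_pos)
          fin_cases i <;> simpa [wR] using h1
        · simp [hz j]
    · refine ⟨1, one_pos, fun L ψ => ?_⟩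
      intro H E₀ hψ
      rw [re_star_dotProduct_diagonal_mulVec, re_star_dotProduct_self, Finset.mul_sum]
      have hxU : (x L : ℝ) ≠ U := fun h => hrat ⟨x L, h⟩
      have hH : H = diagonal fun i => ((tR L i + U * dR L i : ℝ) : ℂ) := hpencil L U
      have hψ' := (Submodule.mem_inf.1 hψ).2
      rw [hH] at hψ'
      have hz := hvanish L U hxU ψ hψ'
      refine Finset.sum_le_sum fun i _ => ?_
      rcases i with i | j
      · refine mul_le_mul_of_nonneg_right ?_ (sq_nonneg _)
        fin_cases i <;> simp [wR]
      · simp [hz j]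
  · -- (ii) failure of the uniform average floor on every sub-window
    intro a b c ha hab hb1 hc
    obtain ⟨q, haq, hqb, hden⟩ := exists_rat_mem_Ioo_lt_den ha hab (4 / c)
    refine ⟨q, ⟨haq, hqb⟩, fun L₀ => ?_⟩
    -- an even size `L ≥ L₀, ⌈4/c⌉₊` whose touching coupling is `q`
    set K : ℕ := Nat.pair (Denumerable.eqv ℚ q) (max L₀ ⌈4 / c⌉₊) with hK
    have hKge : max L₀ ⌈4 / c⌉₊ ≤ K := Nat.right_le_pair _ _
    refine ⟨2 * K, le_trans (le_max_left _ _) (le_trans hKge (by omega)), even_two_mul K, ?_⟩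
    intro H E₀ P
    have hxq : x (2 * K) = q := by
      show (Denumerable.eqv ℚ).symm ((2 * K) / 2).unpair.1 = q
      rw [Nat.mul_div_cancel_left K two_pos, hK, Nat.unpair_pair]
      exact (Denumerable.eqv ℚ).symm_apply_apply q
    -- at `U = q = x_L` the pencil vanishes, so the ground space is everything and `P = 1`
    have hH0 : H = 0 := by
      show (diagonal fun i => (tR (2 * K) i : ℂ)) + ((q : ℝ) : ℂ) • (diagonal fun i =>
        (dR (2 * K) i : ℂ)) = 0
      rw [hpencil]
      have : (fun i => ((tR (2 * K) i + (q : ℝ) * dR (2 * K) i : ℝ) : ℂ)) = 0 := by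
        ext i
        rcases i with i | j
        · fin_cases i <;> simp [tR, dR, hxq]
        · simp only [tR, dR, Sum.elim_inr, hxq, Pi.zero_apply, Complex.ofReal_eq_zero]; ring
      rw [this]
      exact diagonal_zero
    have hmin : (0 : Matrix (Fin 2 ⊕ Fin (2 * K + 1)) (Fin 2 ⊕ Fin (2 * K + 1)) ℂ).minEnergyOn ⊤
        = 0 := by
      unfold Matrix.minEnergyOn
      have hset : {E : ℝ | ∃ ψ ∈ (⊤ : Submodule ℂ (Fin 2 ⊕ Fin (2 * K + 1) → ℂ)),
          star ψ ⬝ᵥ ψ = 1 ∧ E = (star ψ ⬝ᵥ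
            (0 : Matrix (Fin 2 ⊕ Fin (2 * K + 1)) (Fin 2 ⊕ Fin (2 * K + 1)) ℂ) *ᵥ ψ).re} =
          {0} := by
        ext E
        simp only [Set.mem_setOf_eq, Set.mem_singleton_iff, zero_mulVec, dotProduct_zero,
          Complex.zero_re]
        constructor
        · rintro ⟨ψ, -, -, rfl⟩; rfl
        · rintro rfl
          exact ⟨Pi.single (Sum.inl 0) 1, Submodule.mem_top, hunit _ _, rfl⟩
      rw [hset, csInf_singleton]
    have hE : E₀ = ⊤ := by
      show (⊤ : Submodule ℂ (Fin 2 ⊕ Fin (2 * K + 1) → ℂ)) ⊓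
        Module.End.eigenspace (Matrix.toLin' H) ((H.minEnergyOn ⊤ : ℝ) : ℂ) = ⊤
      rw [hH0, hmin, Complex.ofReal_zero, Module.End.eigenspace_zero, map_zero, LinearMap.ker_zero,
        top_inf_eq]
    have hP : P = 1 := by
      show projMatrix (E₀.map ((WithLp.linearEquiv 2 ℂ (Fin 2 ⊕ Fin (2 * K + 1) → ℂ)).symm :
          (Fin 2 ⊕ Fin (2 * K + 1) → ℂ) →ₗ[ℂ] EuclideanSpace ℂ (Fin 2 ⊕ Fin (2 * K + 1)))) = 1
      rw [hE]
      exact (eq_projMatrix_map_of_mulVec ⊤ isHermitian_one (fun k _ => one_mulVec k)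
        (fun _ => Submodule.mem_top)).symm
    rw [hP, Matrix.one_mul, trace_diagonal, trace_one, Complex.re_sum]
    simp only [Complex.ofReal_re, Complex.natCast_re, Fintype.card_sum, Fintype.card_fin]
    rw [Fintype.sum_sum_type, Fin.sum_univ_two]
    simp only [wR, Sum.elim_inl, Sum.elim_inr, Matrix.cons_val_zero, Matrix.cons_val_one,
      Finset.sum_const, Finset.card_univ, Fintype.card_fin, nsmul_eq_mul, hxq]
    -- arithmetic: `2 + (2K+1)/den q < c (2 + (2K+1))` from `den q > 4/c` and `2K ≥ ⌈4/c⌉₊`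
    have hden_pos : (0 : ℝ) < q.den := by exact_mod_cast q.den_pos
    have hinv : ((q.den : ℝ))⁻¹ < c / 4 := by
      rw [inv_eq_one_div, div_lt_div_iff₀ hden_pos (by norm_num : (0:ℝ) < 4)]
      have := (div_lt_iff₀ hc).1 hden
      linarith
    have hL : (4 / c : ℝ) ≤ (2 * K : ℕ) := by
      have h1 : (4 / c : ℝ) ≤ ⌈4 / c⌉₊ := Nat.le_ceil _
      have h2 : (⌈4 / c⌉₊ : ℝ) ≤ (2 * K : ℕ) := by
        exact_mod_cast le_trans (le_max_right L₀ _) (le_trans hKge (by omega))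
      linarith
    have hcL : 4 ≤ c * ((2 * K : ℕ) : ℝ) := by
      have := (div_le_iff₀ hc).1 hL
      linarith
    have hKpos : (0 : ℝ) ≤ ((2 * K + 1 : ℕ) : ℝ) := by positivity
    have hprod : ((2 * K + 1 : ℕ) : ℝ) * ((q.den : ℝ))⁻¹ ≤ ((2 * K + 1 : ℕ) : ℝ) * (c / 4) :=
      mul_le_mul_of_nonneg_left hinv.le hKpos
    push_cast at hcL hKpos hprod ⊢
    nlinarith

end Summit.HubbardSuperconductivity.HubbardSuperconductivity.Theorems.BirGroundStateAverageLRO.Negative
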